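import Mathlib
import Summits.KontsevichZagierPeriods.KontsevichZagierPeriods.Theorems.SoloInformedNashSymbol
import Literature.ModelTheory.ExponentialFields.RealExpFieldProofs
import HarnessLib

/-!
# SoloInformed — Nash charts: holomorphic charts of a smooth `ℚ̄`-curve are `ℚ`-semialgebraic

File G of the Nash-replacement construction (APPROX) of `paper/rung2-v2.md` §4.4. For an embedded
smooth affine curve `Z ⊂ ℂⁿ` over `ℚ̄` the tree provides local holomorphic charts
`ψ : B → Z(ℂ) ∩ Ω` over a coordinate `x_{i₀}` with the *graph property* `Z(ℂ) ∩ Ω = ψ(B)`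
(`CurveData.IsSmoothAffineCurve.exists_localChart`). Here we show that such a chart is
`ℚ`-semialgebraic in real coordinates wherever it is pinned down by a `ℚ`-semialgebraic window
`W ⊆ Ω`: if `c : ℝ^m → B` has `ℚ`-semialgebraic real and imaginary parts on `s` and
`ψ(c(s)) ⊆ W`, then every coordinate of `u ↦ ψ(c(u))` has `ℚ`-semialgebraic real and imaginary
parts on `s` (`soloInformed_reImSA_chart`). The graph of `Re ψⱼ ∘ c` is the coordinate
projection (Tarski–Seidenberg, `IsSemialgebraic.image_comp_of_finite`) of the `ℚ`-semialgebraic set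
`{(u, z) | u ∈ s, z ∈ Z(ℂ) ∩ W, z_{i₀} = c(u)}`, by uniqueness in the graph property.
Ingredients: the realification `soloInformedCx / soloInformedRx` of `ℂⁿ`, `ℚ`-semialgebraicity of
`Z(ℂ)` in real coordinates (`soloInformed_isSemialgebraic_cxPoints`; the equations have algebraic
coefficients) and of Gaussian-rational boxes (`soloInformedCxBox`).
References: Bochnak–Coste–Roy 1998, §2.2 and Prop. 8.1.8 (Nash functions); Huber–Wüstholz 2022,
§3.3.1.
-/

noncomputable section

open Set MvPolynomial
open Literature.NumberTheory.Transcendental Literature.NumberTheory.Transcendental.KZ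
open Literature.NumberTheory.Transcendental.CurvePeriods
open Literature.ModelTheory.ExponentialFields (IsSemialgebraic isSemialgebraic_setOf_eval_lt)

namespace Summit.KontsevichZagierPeriods.KontsevichZagierPeriods.Theorems

variable {n : ℕ}

/-! ### Realification of `ℂⁿ` -/

/-- The complex vector with real parts `x ∘ castAdd` and imaginary parts `x ∘ natAdd`. -/
def soloInformedCx (n : ℕ) (x : Fin (n + n) → ℝ) : Fin n → ℂ :=
  fun i => ⟨x (Fin.castAdd n i), x (Fin.natAdd n i)⟩

/-- The real coordinates (real parts, then imaginary parts) of a complex vector. -/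
def soloInformedRx (n : ℕ) (z : Fin n → ℂ) : Fin (n + n) → ℝ :=
  Fin.append (fun i => (z i).re) (fun i => (z i).im)

/-- Real part of a coordinate of `soloInformedCx`. -/
@[simp] theorem soloInformedCx_re (x : Fin (n + n) → ℝ) (i : Fin n) :
    (soloInformedCx n x i).re = x (Fin.castAdd n i) := rfl

/-- Imaginary part of a coordinate of `soloInformedCx` (`simp`-normal form `i.addNat n`). -/
@[simp] theorem soloInformedCx_im (x : Fin (n + n) → ℝ) (i : Fin n) :
    (soloInformedCx n x i).im = x (i.addNat n) := by
  rw [← Fin.natAdd_eq_addNat]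
  rfl

/-- The first block of `soloInformedRx` consists of the real parts. -/
@[simp] theorem soloInformedRx_castAdd (z : Fin n → ℂ) (i : Fin n) :
    soloInformedRx n z (Fin.castAdd n i) = (z i).re := by
  unfold soloInformedRx
  exact Fin.append_left _ _ i

/-- The second block of `soloInformedRx` consists of the imaginary parts. -/
theorem soloInformedRx_natAdd (z : Fin n → ℂ) (i : Fin n) :
    soloInformedRx n z (Fin.natAdd n i) = (z i).im := by
  unfold soloInformedRx
  exact Fin.append_right _ _ i

/-- The second block of `soloInformedRx` (`simp`-normal form `i.addNat n`). -/
@[simp] theorem soloInformedRx_addNat (z : Fin n → ℂ) (i : Fin n) :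
    soloInformedRx n z (i.addNat n) = (z i).im := by
  rw [← Fin.natAdd_eq_addNat]
  exact soloInformedRx_natAdd z i

/-- `soloInformedRx` is continuous. -/
theorem soloInformed_continuous_rx : Continuous (soloInformedRx n) := by
  refine continuous_pi fun k => ?_
  induction k using Fin.addCases with
  | left i =>
    simp only [soloInformedRx_castAdd]
    exact Complex.continuous_re.comp (continuous_apply i)
  | right i =>
    simp only [soloInformedRx_natAdd]
    exact Complex.continuous_im.comp (continuous_apply i)

/-- `Cx ∘ Rx = id`. -/
@[simp] theorem soloInformedCx_rx (z : Fin n → ℂ) : soloInformedCx n (soloInformedRx n z) = z := by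
  funext i
  apply Complex.ext <;> simp

/-- `Rx ∘ Cx = id`. -/
@[simp] theorem soloInformedRx_cx (x : Fin (n + n) → ℝ) :
    soloInformedRx n (soloInformedCx n x) = x := by
  funext k
  induction k using Fin.addCases <;> simp

/-- The coordinates of `soloInformedCx` have `ℚ`-semialgebraic real and imaginary parts. -/
theorem soloInformed_reImSA_cx {s : Set (Fin (n + n) → ℝ)} (hs : IsSemialgebraic ℚ s) (i : Fin n) :
    SoloInformedReImSA s (fun x => soloInformedCx n x i) := by
  constructor
  · simpa using isSemialgebraicFunOn_aeval (k := ℚ) hs (X (Fin.castAdd n i))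
  · simpa using isSemialgebraicFunOn_aeval (k := ℚ) hs (X (Fin.natAdd n i))

/-! ### Zero sets, the curve and boxes in real coordinates -/

/-- The zero set of a complex function with `ℚ`-semialgebraic real and imaginary parts is
`ℚ`-semialgebraic (both the real and the imaginary part vanish; each zero set is
`{f ≥ 0} ∩ {−f ≥ 0}`). [BCR 1998, §2.2] -/
theorem SoloInformedReImSA.isSemialgebraic_zeroSet {m : ℕ} {s : Set (Fin m → ℝ)}
    {F : (Fin m → ℝ) → ℂ} (hF : SoloInformedReImSA s F) :
    IsSemialgebraic ℚ {x | x ∈ s ∧ F x = 0} := by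
  have hz : ∀ {f : (Fin m → ℝ) → ℝ}, IsSemialgebraicFunOn ℚ s f →
      IsSemialgebraic ℚ {x | x ∈ s ∧ f x = 0} := by
    intro f hf
    convert hf.isSemialgebraic_sep_nonneg.inter hf.neg.isSemialgebraic_sep_nonneg using 1
    ext x
    simp only [mem_setOf_eq, mem_inter_iff, Pi.neg_apply, neg_nonneg]
    constructor
    · rintro ⟨hx, h0⟩
      exact ⟨⟨hx, h0.ge⟩, hx, h0.le⟩
    · rintro ⟨⟨hx, h1⟩, -, h2⟩
      exact ⟨hx, le_antisymm h2 h1⟩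
  convert (hz hF.1).inter (hz hF.2) using 1
  ext x
  simp only [mem_setOf_eq, mem_inter_iff, Complex.ext_iff, Complex.zero_re, Complex.zero_im]
  tauto

/-- **`Z(ℂ)` is `ℚ`-semialgebraic in real coordinates** (inside any `ℚ`-semialgebraic set), for
equations with algebraic coefficients. [BCR 1998, §2.2; Huber–Wüstholz 2022, §3.3.1] -/
theorem soloInformed_isSemialgebraic_cxPoints (Z : CurveData) (hF : ∀ j, HasAlgCoeffs (Z.F j))
    {s : Set (Fin (Z.n + Z.n) → ℝ)} (hs : IsSemialgebraic ℚ s) :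
    IsSemialgebraic ℚ {x | x ∈ s ∧ soloInformedCx Z.n x ∈ Z.points} := by
  have h : ∀ j, IsSemialgebraic ℚ
      {x | x ∈ s ∧ eval (soloInformedCx Z.n x) (Z.F j) = 0} := fun j =>
    (SoloInformedReImSA.eval_poly hs (fun i => soloInformed_reImSA_cx hs i)
      (hF j)).isSemialgebraic_zeroSet
  convert hs.inter (IsSemialgebraic.biInter Finset.univ _ fun j _ => h j) using 1
  ext x
  simp only [mem_setOf_eq, mem_inter_iff, CurveData.mem_points, Finset.mem_univ, mem_iInter,
    true_imp_iff]
  exact ⟨fun hx => ⟨hx.1, fun j => ⟨hx.1, hx.2 j⟩⟩, fun hx => ⟨hx.1, fun j => (hx.2 j).2⟩⟩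

/-- The open Gaussian-rational box `∏ₖ (aₖ, bₖ)` in `ℂⁿ` (real coordinates `soloInformedRx`). -/
def soloInformedCxBox (n : ℕ) (a b : Fin (n + n) → ℚ) : Set (Fin n → ℂ) :=
  {z | ∀ k, (a k : ℝ) < soloInformedRx n z k ∧ soloInformedRx n z k < (b k : ℝ)}

/-- Membership in a box, unfolded. -/
theorem soloInformed_mem_cxBox {a b : Fin (n + n) → ℚ} {z : Fin n → ℂ} :
    z ∈ soloInformedCxBox n a b ↔
      ∀ k, (a k : ℝ) < soloInformedRx n z k ∧ soloInformedRx n z k < (b k : ℝ) :=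
  Iff.rfl

/-- Gaussian-rational boxes are open. -/
theorem soloInformed_isOpen_cxBox (a b : Fin (n + n) → ℚ) : IsOpen (soloInformedCxBox n a b) := by
  simp only [soloInformedCxBox, setOf_forall]
  exact isOpen_iInter_of_finite fun k =>
    (isOpen_lt continuous_const ((continuous_apply k).comp soloInformed_continuous_rx)).inter
      (isOpen_lt ((continuous_apply k).comp soloInformed_continuous_rx) continuous_const)

/-- Gaussian-rational boxes are `ℚ`-semialgebraic in real coordinates. [BCR 1998, §2.1] -/
theorem soloInformed_isSemialgebraic_cxBox (a b : Fin (n + n) → ℚ) :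
    IsSemialgebraic ℚ {x : Fin (n + n) → ℝ | soloInformedCx n x ∈ soloInformedCxBox n a b} := by
  have h1 : ∀ k, IsSemialgebraic ℚ
      ({x : Fin (n + n) → ℝ | (a k : ℝ) < x k} ∩ {x | x k < (b k : ℝ)}) := by
    intro k
    have ha := isSemialgebraic_setOf_eval_lt (k := ℚ) (R := ℝ)
      (C (a k) : MvPolynomial (Fin (n + n)) ℚ) (X k)
    have hb := isSemialgebraic_setOf_eval_lt (k := ℚ) (R := ℝ)
      (X k : MvPolynomial (Fin (n + n)) ℚ) (C (b k))
    simp only [MvPolynomial.aeval_C, MvPolynomial.aeval_X, eq_ratCast] at ha hb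
    exact ha.inter hb
  have hset : {x : Fin (n + n) → ℝ | soloInformedCx n x ∈ soloInformedCxBox n a b} =
      ⋂ k ∈ (Finset.univ : Finset (Fin (n + n))),
        ({x : Fin (n + n) → ℝ | (a k : ℝ) < x k} ∩ {x | x k < (b k : ℝ)}) := by
    ext x
    simp only [mem_setOf_eq, soloInformed_mem_cxBox, soloInformedRx_cx, Finset.mem_univ, mem_iInter,
      mem_inter_iff, true_imp_iff]
  rw [hset]
  exact IsSemialgebraic.biInter _ _ fun k _ => h1 k

/-- Finite unions of Gaussian-rational boxes are `ℚ`-semialgebraic in real coordinates. -/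
theorem soloInformed_isSemialgebraic_cxBoxes {ι : Type*} (T : Finset ι)
    (a b : ι → Fin (n + n) → ℚ) :
    IsSemialgebraic ℚ {x : Fin (n + n) → ℝ |
      soloInformedCx n x ∈ ⋃ i ∈ T, soloInformedCxBox n (a i) (b i)} := by
  have hset : {x : Fin (n + n) → ℝ |
      soloInformedCx n x ∈ ⋃ i ∈ T, soloInformedCxBox n (a i) (b i)} =
      ⋃ i ∈ T, {x | soloInformedCx n x ∈ soloInformedCxBox n (a i) (b i)} := by
    ext x
    simp
  rw [hset]
  exact IsSemialgebraic.biUnion _ _ fun i _ => soloInformed_isSemialgebraic_cxBox (a i) (b i)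

/-! ### Semialgebraic windows -/

/-- Every point of an open subset of `ℂⁿ` lies in a Gaussian-rational box inside it. [folklore] -/
theorem soloInformed_exists_cxBox_subset {U : Set (Fin n → ℂ)} (hU : IsOpen U) {z : Fin n → ℂ}
    (hz : z ∈ U) :
    ∃ a b : Fin (n + n) → ℚ, z ∈ soloInformedCxBox n a b ∧ soloInformedCxBox n a b ⊆ U := by
  obtain ⟨ε, hε, hball⟩ := Metric.isOpen_iff.mp hU z hz
  have hq : ∀ k, ∃ q : ℚ × ℚ, (q.1 : ℝ) < soloInformedRx n z k ∧ soloInformedRx n z k < q.2 ∧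
      soloInformedRx n z k - ε / 4 < q.1 ∧ (q.2 : ℝ) < soloInformedRx n z k + ε / 4 := by
    intro k
    obtain ⟨q₁, h₁, h₁'⟩ := exists_rat_btwn
      (show soloInformedRx n z k - ε / 4 < soloInformedRx n z k by linarith)
    obtain ⟨q₂, h₂, h₂'⟩ := exists_rat_btwn
      (show soloInformedRx n z k < soloInformedRx n z k + ε / 4 by linarith)
    exact ⟨(q₁, q₂), h₁', h₂, h₁, h₂'⟩
  choose q hq using hq
  refine ⟨fun k => (q k).1, fun k => (q k).2, fun k => ⟨(hq k).1, (hq k).2.1⟩,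
    fun w hw => hball ?_⟩
  rw [Metric.mem_ball, dist_pi_lt_iff hε]
  intro i
  have hre := hw (Fin.castAdd n i)
  have him := hw (Fin.natAdd n i)
  have h1 := hq (Fin.castAdd n i)
  have h2 := hq (Fin.natAdd n i)
  rw [soloInformedRx_castAdd] at hre h1
  rw [soloInformedRx_natAdd] at him h2
  obtain ⟨hre1, hre2⟩ := hre
  obtain ⟨him1, him2⟩ := him
  obtain ⟨-, -, h13, h14⟩ := h1
  obtain ⟨-, -, h23, h24⟩ := h2
  rw [Complex.dist_eq]
  have hdec : w i - z i = ((w i - z i).re : ℂ) + ((w i - z i).im : ℂ) * Complex.I :=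
    (Complex.re_add_im _).symm
  calc ‖w i - z i‖ = ‖((w i - z i).re : ℂ) + ((w i - z i).im : ℂ) * Complex.I‖ := by
        rw [← hdec]
    _ ≤ ‖((w i - z i).re : ℂ)‖ + ‖((w i - z i).im : ℂ) * Complex.I‖ := norm_add_le _ _
    _ = |(w i).re - (z i).re| + |(w i).im - (z i).im| := by
        simp only [norm_mul, Complex.norm_I, mul_one, Complex.norm_real, Real.norm_eq_abs,
          Complex.sub_re, Complex.sub_im]
    _ < ε / 2 + ε / 2 := by
        refine add_lt_add (abs_sub_lt_iff.2 ⟨?_, ?_⟩) (abs_sub_lt_iff.2 ⟨?_, ?_⟩) <;> linarith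
    _ = ε := by ring

/-- **Semialgebraic windows.** A compact subset `K` of an open set `U ⊆ ℂⁿ` is contained in a
finite union `W ⊆ U` of Gaussian-rational boxes; `W` is `ℚ`-semialgebraic in real coordinates.
[folklore] -/
theorem soloInformed_exists_window {K U : Set (Fin n → ℂ)} (hK : IsCompact K) (hU : IsOpen U)
    (hKU : K ⊆ U) :
    ∃ W : Set (Fin n → ℂ), K ⊆ W ∧ W ⊆ U ∧ IsSemialgebraic ℚ {x | soloInformedCx n x ∈ W} := by
  classical
  have hbox : ∀ z : K, ∃ ab : (Fin (n + n) → ℚ) × (Fin (n + n) → ℚ),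
      (z : Fin n → ℂ) ∈ soloInformedCxBox n ab.1 ab.2 ∧ soloInformedCxBox n ab.1 ab.2 ⊆ U := by
    intro z
    obtain ⟨a, b, h⟩ := soloInformed_exists_cxBox_subset hU (hKU z.2)
    exact ⟨(a, b), h⟩
  choose ab hmem hsub using hbox
  obtain ⟨T, hT⟩ := hK.elim_finite_subcover (fun z : K => soloInformedCxBox n (ab z).1 (ab z).2)
    (fun z => soloInformed_isOpen_cxBox _ _) (fun z hz => mem_iUnion.2 ⟨⟨z, hz⟩, hmem ⟨z, hz⟩⟩)
  exact ⟨⋃ z ∈ T, soloInformedCxBox n (ab z).1 (ab z).2, hT, iUnion₂_subset fun z _ => hsub z,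
    soloInformed_isSemialgebraic_cxBoxes T (fun z => (ab z).1) (fun z => (ab z).2)⟩

/-! ### Cylinders -/

/-- A function with `ℚ`-semialgebraic real and imaginary parts on `s ⊆ ℝ^m`, viewed on the cylinder
`s × ℝ^q ⊆ ℝ^{m+q}`. [BCR 1998, Prop. 2.2.6] -/
theorem SoloInformedReImSA.cylinder {m q : ℕ} {s : Set (Fin m → ℝ)} (hs : IsSemialgebraic ℚ s)
    {c : (Fin m → ℝ) → ℂ} (hc : SoloInformedReImSA s c) :
    SoloInformedReImSA {p : Fin (m + q) → ℝ | (fun i => p (Fin.castAdd q i)) ∈ s}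
      (fun p => c (fun i => p (Fin.castAdd q i))) := by
  have hS : IsSemialgebraic ℚ {p : Fin (m + q) → ℝ | (fun i => p (Fin.castAdd q i)) ∈ s} :=
    hs.preimage_comp (Fin.castAdd q)
  have hπ : IsSemialgebraicMapOn ℚ {p : Fin (m + q) → ℝ | (fun i => p (Fin.castAdd q i)) ∈ s}
      (fun p i => p (Fin.castAdd q i)) := by
    convert isSemialgebraicMapOn_aeval hS (fun i => X (Fin.castAdd q i)) using 2 with p
    ext i
    simp
  have hmaps : MapsTo (fun (p : Fin (m + q) → ℝ) i => p (Fin.castAdd q i))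
      {p | (fun i => p (Fin.castAdd q i)) ∈ s} s := fun p hp => hp
  exact ⟨IsSemialgebraicFunOn.comp_isSemialgebraicMapOn_holds hc.1 hπ hmaps,
    IsSemialgebraicFunOn.comp_isSemialgebraicMapOn_holds hc.2 hπ hmaps⟩

/-! ### The chart lemma -/

section Chart

variable {Z : CurveData} {i₀ : Fin Z.n} {B : Set ℂ} {Ω W : Set (Fin Z.n → ℂ)}
  {ψ : ℂ → (Fin Z.n → ℂ)} {m : ℕ} {s : Set (Fin m → ℝ)} {c : (Fin m → ℝ) → ℂ}

/-- The set `E = {(u, x) | u ∈ s, Cx x ∈ Z(ℂ) ∩ W, (Cx x)_{i₀} = c u} ⊆ ℝ^{m + 2n}` whose coordinate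
projections are the graphs of the real and imaginary parts of the chart coordinates along `c`. -/
def soloInformedChartSet (Z : CurveData) (i₀ : Fin Z.n) (W : Set (Fin Z.n → ℂ))
    (s : Set (Fin m → ℝ)) (c : (Fin m → ℝ) → ℂ) : Set (Fin (m + (Z.n + Z.n)) → ℝ) :=
  {p | (fun i => p (Fin.castAdd (Z.n + Z.n) i)) ∈ s ∧
    soloInformedCx Z.n (fun k => p (Fin.natAdd m k)) ∈ Z.points ∧
    soloInformedCx Z.n (fun k => p (Fin.natAdd m k)) ∈ W ∧
    soloInformedCx Z.n (fun k => p (Fin.natAdd m k)) i₀ =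
      c (fun i => p (Fin.castAdd (Z.n + Z.n) i))}

/-- `E` is `ℚ`-semialgebraic. [BCR 1998, §2.2] -/
theorem soloInformed_isSemialgebraic_chartSet (hF : ∀ j, HasAlgCoeffs (Z.F j))
    (hW : IsSemialgebraic ℚ {x | soloInformedCx Z.n x ∈ W}) (hs : IsSemialgebraic ℚ s)
    (hc : SoloInformedReImSA s c) :
    IsSemialgebraic ℚ (soloInformedChartSet Z i₀ W s c) := by
  -- the cylinder over `s`
  have hS : IsSemialgebraic ℚ
      {p : Fin (m + (Z.n + Z.n)) → ℝ | (fun i => p (Fin.castAdd (Z.n + Z.n) i)) ∈ s} :=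
    hs.preimage_comp (Fin.castAdd (Z.n + Z.n))
  -- `Cx (p ∘ natAdd) ∈ Z(ℂ) ∩ W`
  have hZW : IsSemialgebraic ℚ {p : Fin (m + (Z.n + Z.n)) → ℝ |
      soloInformedCx Z.n (fun k => p (Fin.natAdd m k)) ∈ Z.points ∧
      soloInformedCx Z.n (fun k => p (Fin.natAdd m k)) ∈ W} := by
    have h := ((soloInformed_isSemialgebraic_cxPoints Z hF
      (Literature.ModelTheory.ExponentialFields.isSemialgebraic_univ (k := ℚ))).inter
      hW).preimage_comp (Fin.natAdd m)
    convert h using 1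
    ext p
    simp [Function.comp_def]
  -- the equation `(Cx x)_{i₀} = c u` on the cylinder
  have hx : ∀ i, SoloInformedReImSA
      {p : Fin (m + (Z.n + Z.n)) → ℝ | (fun i => p (Fin.castAdd (Z.n + Z.n) i)) ∈ s}
      (fun p => soloInformedCx Z.n (fun k => p (Fin.natAdd m k)) i) := by
    intro i
    constructor
    · simpa using isSemialgebraicFunOn_aeval (k := ℚ) hS (X (Fin.natAdd m (Fin.castAdd Z.n i)))
    · simpa using isSemialgebraicFunOn_aeval (k := ℚ) hS (X (Fin.natAdd m (Fin.natAdd Z.n i)))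
  have heq := ((hx i₀).add ((hc.cylinder (q := Z.n + Z.n) hs).mul
    (SoloInformedReImSA.const hS (isAlgebraic_one.neg : IsAlgebraic ℚ (-1 : ℂ)))))
    |>.isSemialgebraic_zeroSet
  convert (hZW.inter heq) using 1
  ext p
  simp only [soloInformedChartSet, mem_setOf_eq, mem_inter_iff, mul_neg, mul_one,
    add_neg_eq_zero]
  tauto

variable (h1 : ∀ z ∈ Ω, z ∈ Z.points → z i₀ ∈ B ∧ ψ (z i₀) = z)
  (h2 : ∀ w ∈ B, ψ w ∈ Ω ∧ ψ w ∈ Z.points ∧ ψ w i₀ = w)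
  (hWΩ : W ⊆ Ω) (hcB : ∀ u ∈ s, c u ∈ B) (hcW : ∀ u ∈ s, ψ (c u) ∈ W)
include h1 h2 hWΩ hcB hcW

/-- The graph of a real coordinate of `ψ ∘ c` over `s` is a coordinate projection of `E`
(uniqueness in the graph property of the chart). [Huber–Wüstholz 2022, §3.3.1] -/
theorem soloInformed_chartGraph_eq (k : Fin (Z.n + Z.n)) :
    {v : Fin (m + 1) → ℝ | ∃ u ∈ s, v = Fin.snoc u (soloInformedRx Z.n (ψ (c u)) k)} =
      (fun p : Fin (m + (Z.n + Z.n)) → ℝ =>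
        p ∘ (Fin.snoc (fun i => Fin.castAdd (Z.n + Z.n) i) (Fin.natAdd m k) : Fin (m + 1) → _)) ''
        soloInformedChartSet Z i₀ W s c := by
  ext v
  simp only [mem_setOf_eq, mem_image]
  constructor
  · rintro ⟨u, hu, rfl⟩
    refine ⟨Fin.append u (soloInformedRx Z.n (ψ (c u))), ?_, ?_⟩
    · have hu' : (fun i => Fin.append u (soloInformedRx Z.n (ψ (c u)))
          (Fin.castAdd (Z.n + Z.n) i)) = u := by
        funext i
        rw [Fin.append_left]
      have hx' : (fun j => Fin.append u (soloInformedRx Z.n (ψ (c u))) (Fin.natAdd m j)) =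
          soloInformedRx Z.n (ψ (c u)) := by
        funext j
        rw [Fin.append_right]
      refine ⟨by rw [hu']; exact hu, ?_, ?_, ?_⟩
      · rw [hx', soloInformedCx_rx]; exact (h2 _ (hcB u hu)).2.1
      · rw [hx', soloInformedCx_rx]; exact hcW u hu
      · rw [hx', hu', soloInformedCx_rx]; exact (h2 _ (hcB u hu)).2.2
    · funext l
      induction l using Fin.lastCases with
      | last => simp
      | cast i => simp
  · rintro ⟨p, ⟨hps, hpZ, hpW, hpi⟩, rfl⟩
    refine ⟨fun i => p (Fin.castAdd (Z.n + Z.n) i), hps, ?_⟩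
    have hz : ψ (c fun i => p (Fin.castAdd (Z.n + Z.n) i)) =
        soloInformedCx Z.n (fun k => p (Fin.natAdd m k)) := by
      rw [← hpi]
      exact (h1 _ (hWΩ hpW) hpZ).2
    funext l
    induction l using Fin.lastCases with
    | last => simp [hz]
    | cast i => simp

/-- **Chart lemma.** In a local chart `ψ` of a smooth affine curve over `ℚ̄` with the graph
property, pinned by a `ℚ`-semialgebraic window `W ⊆ Ω`, the coordinates of `ψ ∘ c` have
`ℚ`-semialgebraic real and imaginary parts on `s` whenever `c` does, `c(s) ⊆ B` and `ψ(c(s)) ⊆ W`.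
[BCR 1998, Prop. 8.1.8; Huber–Wüstholz 2022, §3.3.1] -/
theorem soloInformed_reImSA_chart (hF : ∀ j, HasAlgCoeffs (Z.F j))
    (hW : IsSemialgebraic ℚ {x | soloInformedCx Z.n x ∈ W}) (hs : IsSemialgebraic ℚ s)
    (hc : SoloInformedReImSA s c) (j : Fin Z.n) :
    SoloInformedReImSA s (fun u => ψ (c u) j) := by
  have hE := soloInformed_isSemialgebraic_chartSet (i₀ := i₀) hF hW hs hc
  have hk : ∀ k : Fin (Z.n + Z.n),
      IsSemialgebraicFunOn ℚ s (fun u => soloInformedRx Z.n (ψ (c u)) k) := by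
    intro k
    unfold IsSemialgebraicFunOn
    rw [soloInformed_chartGraph_eq h1 h2 hWΩ hcB hcW k]
    exact hE.image_comp_of_finite _
  constructor
  · simpa using hk (Fin.castAdd Z.n j)
  · simpa using hk (Fin.natAdd Z.n j)

end Chart

end Summit.KontsevichZagierPeriods.KontsevichZagierPeriods.Theorems
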